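import Mathlib
import Literature.Computability.AlgebraicComplexity.GroupTheoreticMatMul

/-!
# Abelian STPP census — the shape-level sieve system (cell mm-stpp, rung F-M1; definitions only)

`SieveAdmissible M a b c` collects, for a list of shapes `(a i, b i, c i)_{i<N}` of positive naturals and an
order `M`, the arithmetic consequences of «an STPP family with these set sizes exists in some finite abelian
group of order `M`» that the cell's sieve (HOME/mm-stpp-plan/feas_scan.py, rule set `vM` = v2 of this file, 2026-08-25T19:1xZ) uses — each one a
kernel-checked or tree theorem about STPP families (U-numbers refer to HOME/CENSUS-PLAN.md §3):
* U1  volume `a b c ≤ M` (injectivity of `(s,t,u) ↦ s+t+u`, abelian);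
* Neumann per member `a(b+c−1) ≤ M` and rotations (single TPP triple);
* U2  packing `Σ ab ≤ M` and rotations (BCCGNSU 2017 §2);
* U11 per member: `Σ_j c_j(a_j+b_j) ≤ M + c_i` for EVERY member `i`, and rotations (Theorem A per block: for a fixed
  `x₀ ∈ B_i − A_i` the `Σbc`-set `x₀ + ⋃_t (C_t − B_t)` and the `Σca`-set `⋃_t (C_t − A_t)` meet in exactly the `c_i` points
  `c − a₀`, by the STPP pattern `(l,i,k)`; HOME/mm-stpp-lit/KNESER-KILLS.md §1, planner-verified 2026-08-25) — it implies the
  tree forms `stpp_neumann_packing` (`M + m`, `m ≥` every size, p402899) and `isSTPP_neumann_packing_sharp` (p403985);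
* U13 isolation: with ≥ 2 members, `V_i + max(a_i,b_i,c_i) ≤ M`;
* U9′ pairs: `a_i b_i + V_j ≤ M` for `i ≠ j`, and rotations;
* U14 one volume + the other pair products: `V_l + Σ_{t≠l} a_t b_t ≤ M` and rotations, with the tightness
  clauses U14-T (equality ⇒ a divisor `d` of `V_l` and `M` with `d ≥` the free member's size) and U14-T″
  (two tight rotations ⇒ `d ≥` the product of the two sizes named by the reversal symmetry).
No claim is made here; the route `AbelianSTPPCensus` carries «STPP ⇒ SieveAdmissible» as a support item and
«SieveAdmissible ∧ M in range ⇒ Σ V^{τ/3} ≤ M» as its arithmetic crux.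
-/

namespace Summit.MatrixMultiplication.MatrixMultiplication.Theorems

open Finset

variable {N : ℕ}

/-- Volume of member `i`. -/
def shapeVol (a b c : Fin N → ℕ) (i : Fin N) : ℕ := a i * b i * c i

/-- U14 slack data: `V_l + Σ_{t ≠ l} x_t y_t` for the rotation whose pair products are `x·y`. -/
def u14Sum (V : Fin N → ℕ) (x y : Fin N → ℕ) (l : Fin N) : ℕ := V l + ∑ t ∈ univ.erase l, x t * y t

/-- «some divisor `d` of `V` and of `M` is at least `f`» — the conclusion of the tightness clauses. -/
def HasLargeCommonDivisor (V M f : ℕ) : Prop := ∃ d : ℕ, f ≤ d ∧ d ∣ V ∧ d ∣ M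

/-- The sieve system `vM` at order `M` for the shape list `(a,b,c)` (v2: U11 per member replaces U11-relaxed + U11♯). -/
def SieveAdmissible (M : ℕ) (a b c : Fin N → ℕ) : Prop :=
  let V := shapeVol a b c
  -- positivity and U1
  (∀ i, 1 ≤ a i ∧ 1 ≤ b i ∧ 1 ≤ c i ∧ V i ≤ M) ∧
  -- Neumann, single member
  (∀ i, a i * (b i + c i - 1) ≤ M ∧ b i * (c i + a i - 1) ≤ M ∧ c i * (a i + b i - 1) ≤ M) ∧
  -- U2 packing
  (∑ i, a i * b i ≤ M ∧ ∑ i, b i * c i ≤ M ∧ ∑ i, c i * a i ≤ M) ∧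
  -- U11 per member (Theorem A per block), three rotations; implies the tree forms `stpp_neumann_packing`
  -- (bound `M + m`, `m ≥` every size) and `isSTPP_neumann_packing_sharp` (multiply by `a i * b i` and sum)
  (∀ i, ∑ j, a j * (b j + c j) ≤ M + a i ∧ ∑ j, b j * (c j + a j) ≤ M + b i ∧ ∑ j, c j * (a j + b j) ≤ M + c i) ∧
  -- U13 isolation and U9′ pairs (two distinct members)
  (∀ i j, i ≠ j → V i + a i ≤ M ∧ V i + b i ≤ M ∧ V i + c i ≤ M ∧
      a i * b i + V j ≤ M ∧ b i * c i + V j ≤ M ∧ c i * a i + V j ≤ M) ∧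
  -- U14 with the single tightness clauses (free member: C for ab, A for bc, B for ca)
  (∀ l, u14Sum V a b l ≤ M ∧ (u14Sum V a b l = M → HasLargeCommonDivisor (V l) M (c l)) ∧
        u14Sum V b c l ≤ M ∧ (u14Sum V b c l = M → HasLargeCommonDivisor (V l) M (a l)) ∧
        u14Sum V c a l ≤ M ∧ (u14Sum V c a l = M → HasLargeCommonDivisor (V l) M (b l))) ∧
  -- U14-T″ product pair clauses (reversal symmetry)
  (∀ l, (u14Sum V a b l = M → u14Sum V b c l = M → HasLargeCommonDivisor (V l) M (a l * c l)) ∧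
        (u14Sum V b c l = M → u14Sum V c a l = M → HasLargeCommonDivisor (V l) M (b l * a l)) ∧
        (u14Sum V c a l = M → u14Sum V a b l = M → HasLargeCommonDivisor (V l) M (c l * b l)))

/-- «the shape list beats exponent `τ` at order `M`»: `Σ_i V_i^{τ/3} > M`. -/
def Beats (τ : ℝ) (M : ℕ) (a b c : Fin N → ℕ) : Prop :=
  (M : ℝ) < ∑ i, ((shapeVol a b c i : ℕ) : ℝ) ^ (τ / 3)

/-- The shape list `(a,b,c)` contains, at pairwise distinct indices, members with exactly the shapes listed in `L`. -/
def HasSubShapes (a b c : Fin N → ℕ) (L : List (ℕ × ℕ × ℕ)) : Prop :=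
  ∃ φ : Fin L.length ↪ Fin N, ∀ r, (a (φ r), b (φ r), c (φ r)) = L.get r

/-- A family of finsets contains, at pairwise distinct indices, members with exactly the set sizes listed in `L`. -/
def HasSubfamilyShapes {H : Type*} (A B C : Fin N → Finset H) (L : List (ℕ × ℕ × ℕ)) : Prop :=
  HasSubShapes (fun i => (A i).card) (fun i => (B i).card) (fun i => (C i).card) L

/-- «no STPP family in any finite abelian group of order `M` contains members of the listed shapes» —
the form of the census's residual existence questions (Q3.8–Q3.12 of HOME/CENSUS-PLAN.md §6.1). -/
def NoSTPPSubfamily (M : ℕ) (L : List (ℕ × ℕ × ℕ)) : Prop :=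
  ∀ (H : Type) [AddCommGroup H] [Fintype H], Fintype.card H = M →
    ∀ (N : ℕ) (A B C : Fin N → Finset H), Literature.Computability.AlgebraicComplexity.IsSTPP A B C →
      ¬ HasSubfamilyShapes A B C L

end Summit.MatrixMultiplication.MatrixMultiplication.Theorems
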